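import Summits.BirchSwinnertonDyer.BirchSwinnertonDyer.Statement
import Literature.NumberTheory.EllipticCurves.PAdicGrossZagier
import Literature.NumberTheory.EllipticCurves.KatoRankBoundLevelZeroProofs
import Literature.NumberTheory.EllipticCurves.GrossZagierRationalPoint
import Literature.NumberTheory.EllipticCurves.RegulatorProofs
import Literature.NumberTheory.EllipticCurves.SelmerCorankHolds
import Literature.NumberTheory.EllipticCurves.AnalyticRankOrderProofs
import Literature.NumberTheory.EllipticCurves.BSDInvariantsProofs
import Literature.NumberTheory.EllipticCurves.GlobalMinimalModelProofs
import Literature.NumberTheory.EllipticCurves.OrdinaryPrimes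
import Literature.NumberTheory.EllipticCurves.LeadingTerm
import Literature.NumberTheory.DiophantineGeometry.Conductor
import Mathlib.LinearAlgebra.Matrix.ToLinearEquiv
import HarnessLib
import HarnessLib.Audit.Tags

/-!
# SoloInformedJointGrossZagier — the joint (archimedean ∧ `p`-adic) higher Gross–Zagier identity
`(ZZ_r)`, typed, and the exact Schneider-type input that turns it into the RANK conjecture

In analytic rank one the tree holds, as ONE named fact, Perrin-Riou's leading-term theorem
`perrinRiou_rankOne_leadingTerms` (Invent. Math. 89 (1987), Thm. 1.3, §1.4 Cor. 1.8; Stein–Wuthrich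
2013 §9): for `r_an(E) = 1`, `p ≥ 5` good ordinary with unit root `α`, THE canonical cyclotomic
`p`-adic height `D` and the newform `f` of `E`, ONE point `P ∈ E(ℚ)` and ONE rational `c` satisfy
`L'(E,1) = c · Ω⁺_f · ĥ(P)` and `[T¹]L_p(f,α,T) · log_p γ = c · (1 - α⁻¹)² · ĥ_p(P)`.
This file types the rank-`r` analogue `(ZZ_r)` (`JointHigherGrossZagier r`: the SAME `c` and the
SAME family `P₁,…,P_r ∈ E(ℚ)` on both sides, Gram determinants `regulatorOf P` /
`padicRegulatorOf D P`; the shape of BSD ∧ `p`-adic BSD, `PAdicBSDConjecture`) and proves,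
sorry-free over named facts:
* `soloInformedJoint_one_of_perrinRiou` / `soloInformedJoint_perrinRiou_of_one`: `(ZZ_1)` IS the
  tree's Perrin-Riou fact (modulo modularity for the non-torsion clause): the first rung is in print.
* `soloInformedJoint_rank_eq`: for ONE curve, `(ZZ_r)` at `r = r_an(E)` + modularity + Kato's bound
  `corank Sel_{p^∞} ≤ ord_T L_p` (Astérisque 295, Thm. 18.4) + non-degeneracy of the canonical
  `p`-adic height ON THE FAMILY `P` give `rank E(ℚ) = r_an(E)`, `corank Ш(E/ℚ)[p^∞] = 0` and
  `ord_T L_p(E,T) = r_an(E)`. Mechanism: `L^{(r)}(E,1)/r! ≠ 0 ⇒ c ≠ 0 ∧ det⟨Pᵢ,Pⱼ⟩ ≠ 0 ⇒ r`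
  independent points (lower bound, no `Ш`); `det⟨Pᵢ,Pⱼ⟩_p ≠ 0 ⇒ [T^r]L_p ≠ 0 ⇒ ord L_p ≤ r ⇒
  corank Sel ≤ r` (Kato) `⇒ rank + corank Ш[p^∞] ≤ r` (upper bound).
* `soloInformedJoint_padicRegulatorOf_eq_zero_of_lt`: conversely, under `(ZZ_r)`, modularity and
  Kato, `rank E(ℚ) > r_an(E)` forces the Gross–Zagier family to span a `p`-adically DEGENERATE
  lattice. So, GIVEN `(ZZ_r)`, the Selmer upper door `(α)` of `SoloInformedRankTwo` is EXACTLY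
  Schneider non-degeneracy on the Gross–Zagier lattice (not Schneider's conjecture proper: a
  sub-lattice of infinite index may be degenerate).
* `soloInformedJoint_schneider_of_anisotropic`: the family form `PAdicHeightAnisotropic` (`ĥ_p`
  non-degenerate on every Néron–Tate-independent family; for one point: `ĥ_p(P) = 0 ⇒ P` torsion,
  Bertrand's theorem for CM curves, Sém. Théorie des Nombres Paris 1980–81, Cor. 4; open otherwise)
  implies `SchneiderConjecture D` for the canonical `D` — flagged as STRONGER than Schneider.
* `soloInformedJoint_birchSwinnertonDyer`: the summit from Gross–Zagier–Kolyvagin (`r_an ≤ 1`),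
  modularity, the supply facts (global minimal model — a tree theorem —, a good ordinary `p ≥ 5`,
  the canonical datum), Kato's theorem, and exactly two open inputs: `(ZZ_r)` for `r ≥ 2` and
  `PAdicHeightAnisotropic`. Versus `SoloInformedHigherGrossZagier` (`(Z_r)` + an unexplained
  Selmer door) the Selmer door is now DERIVED from the `p`-adic half of the identity.
NOT here: any construction of the family for `r ≥ 2` (no receptacle in print; barrier
`Literature.Barriers.BirchSwinnertonDyer.plecticDeterminantVanishesOverQ_holds`), any proof of
`p`-adic non-degeneracy beyond CM rank one.
-/

noncomputable section

open scoped Classical MatrixGroups ModularForm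

open CongruenceSubgroup Literature.NumberTheory.EllipticCurves
  Literature.NumberTheory.EllipticCurves.ModularForms WeierstrassCurve WeierstrassCurve.Affine.Point
  Matrix

namespace Summit.BirchSwinnertonDyer.BirchSwinnertonDyer.Theorems

/-- **`(ZZ_r)`, the joint higher Gross–Zagier identity (conjectural for `r ≥ 2`).** For `E/ℚ`
(globally minimal `W`) of analytic rank `r`, a prime `p ≥ 5` of good ordinary reduction with unit
root `α = unitRoot W p`, THE canonical cyclotomic `p`-adic height datum `D` and the newform `f` of
`E`, there are points `P₁,…,P_r ∈ E(ℚ)` and ONE rational `c` with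
`L^{(r)}(E,1)/r! = c · Ω⁺_f · det(⟨Pᵢ,Pⱼ⟩_NT)` and
`[T^r]L_p(f,α,T) · (log_p γ)^r = c · (1 - α⁻¹)² · det(⟨Pᵢ,Pⱼ⟩_D)`. For `r = 1` this is
Perrin-Riou's theorem (`soloInformedJoint_one_of_perrinRiou`); for general `r` it is the common
shape of BSD and `p`-adic BSD (`PAdicBSDConjecture`) with `Pᵢ` a Mordell–Weil basis and
`c = #Ш ∏ c_v /(#E(ℚ)_tors² ϖ)`. A predicate indexed by `r`, never asserted.
[cite: PerrinRiou1987, Thm. 1.3 and §1.4 Cor. 1.8] -/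
@[conjecture]
def JointHigherGrossZagier (r : ℕ) : Prop :=
  ∀ (W : WeierstrassCurve ℚ) [W.IsElliptic] [W.IsGloballyMinimal] (p : ℕ) [Fact p.Prime],
    5 ≤ p → IsOrdinaryAt W p → W.analyticRank = r →
    ∀ (D : WeierstrassCurve.PAdicHeightData W p), D.IsCanonical →
    ∀ ⦃N : ℕ⦄ [NeZero N] (f : CuspForm (Gamma0 N) 2), IsNewformOf W f →
    ∃ (P : Fin r → W.toAffine.Point) (c : ℚ),
      W.leadingLCoeff = (((c : ℝ) * plusPeriod f * regulatorOf P : ℝ) : ℂ) ∧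
      PowerSeries.coeff r (padicLFunction f (unitRoot W p : ℚ_[p])) *
          padicLog p (cyclotomicGenerator p) ^ r =
        (c : ℚ_[p]) * (1 - (unitRoot W p : ℚ_[p])⁻¹) ^ 2 * padicRegulatorOf D P

/-- **`p`-adic anisotropy of the canonical height on rational points (a family form of
Schneider's conjecture; open, STRONGER than `SchneiderConjecture`).** For `E/ℚ` (globally minimal
`W`), `p ≥ 5` good ordinary and THE canonical datum `D`: every family of rational points with
non-zero Néron–Tate Gram determinant has non-zero `p`-adic Gram determinant. Equivalently: no
point of `E(ℚ) ⊗ ℚ` other than `0` is isotropic for `ĥ_p` inside any rational subspace; for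
one-point families it says `ĥ_p(P) ≠ 0` for non-torsion `P` (Bertrand's theorem for CM curves;
open in general). Implies `SchneiderConjecture D` (`soloInformedJoint_schneider_of_anisotropic`).
Never asserted. [cite: Schneider1982PadicHeightI, §1] -/
@[conjecture]
def PAdicHeightAnisotropic : Prop :=
  ∀ (W : WeierstrassCurve ℚ) [W.IsElliptic] [W.IsGloballyMinimal] (p : ℕ) [Fact p.Prime]
    (D : WeierstrassCurve.PAdicHeightData W p), 5 ≤ p → IsOrdinaryAt W p → D.IsCanonical →
    ∀ ⦃r : ℕ⦄ (P : Fin r → W.toAffine.Point), regulatorOf P ≠ 0 → padicRegulatorOf D P ≠ 0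

section NumberField

variable {K : Type*} [Field K] [NumberField K] {W : WeierstrassCurve K}

/-- The Néron–Tate pairing kills torsion: `⟨P, T⟩ = 0` if `T` has finite order
(bilinearity; Silverman AEC Thm. VIII.9.3(c)). [cite: SilvermanAEC2009, Thm. VIII.9.3(c)] -/
theorem soloInformedJoint_heightPairing_eq_zero_of_isOfFinAddOrder [W.IsElliptic]
    (P Q : W.toAffine.Point) (hQ : IsOfFinAddOrder Q) : heightPairing P Q = 0 := by
  obtain ⟨n, hn, hnQ⟩ := hQ.exists_nsmul_eq_zero
  have h0 : heightPairing P (0 : W.toAffine.Point) = 0 := by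
    have h := heightPairing_zsmul_right (0 : ℤ) P Q
    rwa [zero_zsmul, Int.cast_zero, zero_mul] at h
  have h1 : heightPairing P ((n : ℤ) • Q) = ((n : ℤ) : ℝ) * heightPairing P Q :=
    heightPairing_zsmul_right (n : ℤ) P Q
  rw [natCast_zsmul, hnQ, h0] at h1
  have hn' : ((n : ℤ) : ℝ) ≠ 0 := by exact_mod_cast hn.ne'
  exact (mul_eq_zero.mp h1.symm).resolve_left hn'

/-- **Non-zero Néron–Tate Gram determinant forces independence modulo torsion** (a dependence
relation is an integer kernel vector of the Gram matrix, since the pairing is bilinear and kills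
torsion; Mathlib `Matrix.exists_mulVec_eq_zero_iff`). Converse direction of Silverman AEC
Cor. VIII.9.7. [cite: SilvermanAEC2009, Cor. VIII.9.7] -/
theorem soloInformedJoint_linearIndependent_of_regulatorOf_ne_zero [W.IsElliptic] {ι : Type*}
    [Fintype ι] [DecidableEq ι] {P : ι → W.toAffine.Point} (hReg : regulatorOf P ≠ 0) :
    LinearIndependent ℤ (QuotientAddGroup.mk ∘ P : ι → mordellWeilModTorsion W) := by
  by_contra hli
  obtain ⟨z, hz0, i₀, hi₀⟩ := Fintype.not_linearIndependent_iff.mp hli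
  have hT : IsOfFinAddOrder (∑ i, z i • P i) := by
    have h : QuotientAddGroup.mk' (AddCommGroup.torsion W.toAffine.Point) (∑ i, z i • P i) = 0 := by
      simpa only [map_sum, map_zsmul, QuotientAddGroup.mk'_apply, Function.comp_apply] using hz0
    exact (QuotientAddGroup.eq_zero_iff _).mp h
  have hker : heightPairingMatrix P *ᵥ (fun i => (z i : ℝ)) = 0 := by
    funext j
    simp only [Matrix.mulVec, dotProduct, heightPairingMatrix_apply, Pi.zero_apply]
    calc ∑ i, heightPairing (P j) (P i) * (z i : ℝ)
        = ∑ i, heightPairing (P j) (z i • P i) := by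
          refine Finset.sum_congr rfl fun i _ => ?_
          rw [heightPairing_zsmul_right, mul_comm]
      _ = heightPairing (P j) (∑ i, z i • P i) := (heightPairing_sum_right _ _ _).symm
      _ = 0 := soloInformedJoint_heightPairing_eq_zero_of_isOfFinAddOrder _ _ hT
  have hz : (fun i => (z i : ℝ)) ≠ 0 := by
    intro h
    apply hi₀
    have h' : ((z i₀ : ℤ) : ℝ) = 0 := by simpa using congr_fun h i₀
    exact_mod_cast h'
  exact hReg (Matrix.exists_mulVec_eq_zero_iff.mp ⟨_, hz, hker⟩)

/-- **Independent points bound the rank from below** (Mordell–Weil: `E(K)/tors` is free of rank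
`rank_ℤ E(K)`; `module_finite_point_holds`, `finrank_mordellWeilModTorsion_eq_holds`).
Silverman AEC VIII.6. [cite: SilvermanAEC2009, Thm. VIII.6.7] -/
theorem soloInformedJoint_card_le_mordellWeilRank_of_linearIndependent [W.IsElliptic] {ι : Type*}
    [Fintype ι] {P : ι → W.toAffine.Point}
    (hP : LinearIndependent ℤ (QuotientAddGroup.mk ∘ P : ι → mordellWeilModTorsion W)) :
    Fintype.card ι ≤ W.mordellWeilRank := by
  haveI : Module.Finite ℤ W.toAffine.Point := module_finite_point_holds W
  haveI : Module.Finite ℤ (mordellWeilModTorsion W) :=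
    Module.Finite.of_surjective
      ((QuotientAddGroup.mk' (AddCommGroup.torsion W.toAffine.Point)).toIntLinearMap)
      (QuotientAddGroup.mk'_surjective (AddCommGroup.torsion W.toAffine.Point))
  have hfin : Module.finrank ℤ (mordellWeilModTorsion W) = W.mordellWeilRank :=
    finrank_mordellWeilModTorsion_eq_holds W
  rw [← hfin]
  exact hP.fintype_card_le_finrank

end NumberField

/-! ### The first rung: `(ZZ_1)` is Perrin-Riou's theorem -/

/-- `det` of a `1 × 1` Néron–Tate Gram matrix: `regulatorOf (P) = ⟨P,P⟩ = ĥ(P)`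
(`heightPairing_self_holds`; Silverman AEC Thm. VIII.9.3). [cite: SilvermanAEC2009, Thm. VIII.9.3(c)] -/
theorem soloInformedJoint_regulatorOf_fin_one (W : WeierstrassCurve ℚ) [W.IsElliptic]
    (P : Fin 1 → W.toAffine.Point) : regulatorOf P = (P 0).canonicalHeight := by
  rw [regulatorOf, Matrix.det_unique, heightPairingMatrix_apply]
  exact heightPairing_self_holds (P 0)

/-- `det` of a `1 × 1` `p`-adic Gram matrix: `padicRegulatorOf D (P) = ⟨P,P⟩_D`
(MTT 1986, §II.4). [cite: MazurTateTeitelbaum1986Invent, §II.4] -/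
theorem soloInformedJoint_padicRegulatorOf_fin_one (W : WeierstrassCurve ℚ) (p : ℕ) [Fact p.Prime]
    (D : WeierstrassCurve.PAdicHeightData W p) (P : Fin 1 → W.toAffine.Point) :
    padicRegulatorOf D P = D.pairing (P 0) (P 0) := by
  unfold padicRegulatorOf
  rw [show D.pairing (P 0) (P 0) = D.pairingMatrix P default default from rfl]
  -- `padicRegulatorOf` bakes in the classical `DecidableEq (Fin 1)`; `convert` bridges instances
  convert Matrix.det_unique (D.pairingMatrix P)

/-- **`(ZZ_1)` from Perrin-Riou's theorem.** `JointHigherGrossZagier 1` follows from the tree fact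
`perrinRiou_rankOne_leadingTerms` (Perrin-Riou 1987, Thm. 1.3, §1.4 Cor. 1.8; Stein–Wuthrich 2013
§9): take the one-point family; `L^{(1)}(E,1)/1! = L'(E,1)`
(`leadingLCoeff_eq_deriv_of_analyticRank_eq_one`), `det(ĥ(P)) = ĥ(P)`, `det(ĥ_p(P)) = ĥ_p(P)`.
[cite: PerrinRiou1987, Thm. 1.3 and §1.4 Cor. 1.8] -/
theorem soloInformedJoint_one_of_perrinRiou (h : perrinRiou_rankOne_leadingTerms) :
    JointHigherGrossZagier 1 := by
  intro W _ _ p _ hp hord h1 D hD N _ f hf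
  obtain ⟨P, c, -, hL, hLp⟩ := h W p hp hord h1 D hD f hf
  refine ⟨fun _ => P, c, ?_, ?_⟩
  · rw [(leadingLCoeff_eq_deriv_of_analyticRank_eq_one h1).1, hL,
      soloInformedJoint_regulatorOf_fin_one]
  · rw [pow_one, hLp, soloInformedJoint_padicRegulatorOf_fin_one]

/-- **Perrin-Riou's fact back from `(ZZ_1)`, given modularity.** Over `hasEntireLFunction_rat`
(so that `L'(E,1) ≠ 0` at analytic rank one, `leadingLCoeff_ne_zero_holds`), `JointHigherGrossZagier 1`
returns `perrinRiou_rankOne_leadingTerms`: the point of the one-point family is non-torsion because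
its height `ĥ(P) = det` is non-zero (the pairing kills torsion). So the rung `r = 1` of `(ZZ_r)` is
literally the theorem in print. [cite: PerrinRiou1987, Thm. 1.3 and §1.4 Cor. 1.8] -/
theorem soloInformedJoint_perrinRiou_of_one (hE : hasEntireLFunction_rat)
    (h : JointHigherGrossZagier 1) : perrinRiou_rankOne_leadingTerms := by
  intro W _ _ p _ hp hord h1 D hD N _ f hf
  obtain ⟨P, c, hL, hLp⟩ := h W p hp hord h1 D hD f hf
  have hne : W.leadingLCoeff ≠ 0 := leadingLCoeff_ne_zero_holds (W := W) (hE W)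
  have hReg : regulatorOf P ≠ 0 := by
    intro h0
    apply hne
    rw [hL, h0, mul_zero, Complex.ofReal_zero]
  refine ⟨P 0, c, ?_, ?_, ?_⟩
  · intro hT
    apply hReg
    rw [regulatorOf, Matrix.det_unique, heightPairingMatrix_apply]
    -- `convert` bridges `instDecidableEqRat` (fact) and the classical instance (general-`K` lemma)
    exact soloInformedJoint_heightPairing_eq_zero_of_isOfFinAddOrder _ _ (by convert hT)
  · rw [← (leadingLCoeff_eq_deriv_of_analyticRank_eq_one h1).1, hL,
      soloInformedJoint_regulatorOf_fin_one]
  · rw [← soloInformedJoint_padicRegulatorOf_fin_one, ← hLp, pow_one]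

/-! ### One curve: `(ZZ_r)` + Kato + non-degeneracy on the family ⇒ RANK, `corank Ш[p^∞] = 0` -/

section OneCurve

variable (W : WeierstrassCurve ℚ) [W.IsElliptic] [W.IsGloballyMinimal] (p : ℕ) [Fact p.Prime]
  {N : ℕ} [NeZero N] (f : CuspForm (Gamma0 N) 2)

omit [W.IsGloballyMinimal] [NeZero N] in
/-- From the archimedean identity and `L^{(r)}(E,1)/r! ≠ 0` (modularity): `c ≠ 0` and
`det⟨Pᵢ,Pⱼ⟩ ≠ 0`. [folklore] -/
theorem soloInformedJoint_ne_zero_of_leadingLCoeff (hE : hasEntireLFunction_rat) {r : ℕ}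
    {P : Fin r → W.toAffine.Point} {c : ℚ}
    (hL : W.leadingLCoeff = (((c : ℝ) * plusPeriod f * regulatorOf P : ℝ) : ℂ)) :
    c ≠ 0 ∧ regulatorOf P ≠ 0 := by
  have hne : W.leadingLCoeff ≠ 0 := leadingLCoeff_ne_zero_holds (W := W) (hE W)
  rw [hL] at hne
  have hne' : (c : ℝ) * plusPeriod f * regulatorOf P ≠ 0 := by
    intro h0
    apply hne
    rw [h0, Complex.ofReal_zero]
  refine ⟨?_, (mul_ne_zero_iff.mp hne').2⟩
  have hc : (c : ℝ) ≠ 0 := (mul_ne_zero_iff.mp (mul_ne_zero_iff.mp hne').1).1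
  exact_mod_cast hc

/-- **RANK for one curve from `(ZZ_r)`, Kato and non-degeneracy on the Gross–Zagier family.** Let
`E/ℚ` (globally minimal `W`) have analytic rank `r`, `p ≥ 5` good ordinary, `D` the canonical
`p`-adic height datum, `f` the newform of `E`. Assume `(ZZ_r)` (`JointHigherGrossZagier r`),
modularity (`hasEntireLFunction_rat`), Kato's bound `corank_{ℤ_p} Sel_{p^∞}(E/ℚ) ≤ ord_T L_p(E,T)`
(`kato_selmerCorank_le_order_padicLFunction`, Astérisque 295 (2004) Thm. 18.4) and that the
canonical `p`-adic height is non-degenerate on every Néron–Tate-independent `r`-family of `E(ℚ)`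
(`hSch`). Then `rank E(ℚ) = r`, `corank Ш(E/ℚ)[p^∞] = 0` and `ord_{T=0} L_p(E,T) = r`.
Lower bound: `L^{(r)}(E,1)/r! ≠ 0 ⇒ det⟨Pᵢ,Pⱼ⟩ ≠ 0 ⇒` independence `⇒ r ≤ rank`; upper bound:
`det⟨Pᵢ,Pⱼ⟩_p ≠ 0`, `c ≠ 0`, `1 - α⁻¹ ≠ 0` (`one_sub_unitRoot_inv_ne_zero`) `⇒ [T^r]L_p ≠ 0 ⇒
ord L_p ≤ r ⇒ corank Sel ≤ r` (Kato) `⇒ rank + corank Ш[p^∞] ≤ r`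
(`selmerCorank_eq_mordellWeilRank_add_holds`, Greenberg LNM 1716 §1). [cite: Kato2004, Thm 18.4] -/
theorem soloInformedJoint_rank_eq {r : ℕ} (hZZ : JointHigherGrossZagier r)
    (hE : hasEntireLFunction_rat) (hp : 5 ≤ p) (hord : IsOrdinaryAt W p)
    (hr : W.analyticRank = r) (D : WeierstrassCurve.PAdicHeightData W p) (hD : D.IsCanonical)
    (hf : IsNewformOf W f)
    (hKato : kato_selmerCorank_le_order_padicLFunction W p (f := f))
    (hSch : ∀ P : Fin r → W.toAffine.Point, regulatorOf P ≠ 0 → padicRegulatorOf D P ≠ 0) :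
    W.mordellWeilRank = r ∧ W.shaCorank p = 0 ∧
      (padicLFunction f (unitRoot W p : ℚ_[p])).order = r := by
  obtain ⟨P, c, hL, hLp⟩ := hZZ W p hp hord hr D hD f hf
  obtain ⟨hc, hReg⟩ := soloInformedJoint_ne_zero_of_leadingLCoeff W f hE hL
  have hLB : r ≤ W.mordellWeilRank := by
    simpa using soloInformedJoint_card_le_mordellWeilRank_of_linearIndependent
      (soloInformedJoint_linearIndependent_of_regulatorOf_ne_zero hReg)
  have hRegp : padicRegulatorOf D P ≠ 0 := hSch P hReg
  have hα : (1 : ℚ_[p]) - ((unitRoot W p : ℤ_[p]) : ℚ_[p])⁻¹ ≠ 0 :=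
    one_sub_unitRoot_inv_ne_zero W p hord
  have hp2 : p ≠ 2 := by omega
  have hcoeff : PowerSeries.coeff r (padicLFunction f (unitRoot W p : ℚ_[p])) ≠ 0 := by
    intro h0
    have h1 : (c : ℚ_[p]) * (1 - (unitRoot W p : ℚ_[p])⁻¹) ^ 2 * padicRegulatorOf D P = 0 := by
      rw [← hLp, h0, zero_mul]
    have hcp : (c : ℚ_[p]) ≠ 0 := by exact_mod_cast hc
    exact (mul_ne_zero (mul_ne_zero hcp (pow_ne_zero _ hα)) hRegp) h1
  have hord_le : (padicLFunction f (unitRoot W p : ℚ_[p])).order ≤ r :=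
    PowerSeries.order_le r hcoeff
  have hKato' : (W.selmerCorank p : ℕ∞) ≤ (padicLFunction f (unitRoot W p : ℚ_[p])).order :=
    hKato hp2 hord hf
  have hSel : W.selmerCorank p ≤ r := by exact_mod_cast hKato'.trans hord_le
  have hid : W.selmerCorank p = W.mordellWeilRank + W.shaCorank p :=
    W.selmerCorank_eq_mordellWeilRank_add_holds p
  refine ⟨by omega, by omega, le_antisymm hord_le ?_⟩
  have h1 : ((r : ℕ) : ℕ∞) ≤ (W.selmerCorank p : ℕ∞) := by
    exact_mod_cast (show r ≤ W.selmerCorank p by omega)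
  exact h1.trans hKato'

/-- **The converse reading: excess rank forces `p`-adic degeneracy of the Gross–Zagier lattice.**
Same setting; let `(P, c)` satisfy the two identities of `(ZZ_r)` for `E` (analytic rank `r`).
Over modularity and Kato's bound, if `rank E(ℚ) > r` then `det⟨Pᵢ,Pⱼ⟩_D = 0` (and `[T^r]L_p = 0`):
`ord L_p ≥ corank Sel ≥ rank > r` kills the `r`-th coefficient, and `c ≠ 0`, `1 - α⁻¹ ≠ 0`. Hence,
GIVEN `(ZZ_r)`, the Selmer upper door `corank Sel_{p^∞} ≤ r_an` is equivalent to Schneider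
non-degeneracy on the lattice spanned by the Gross–Zagier family. [cite: Kato2004, Thm 18.4] -/
theorem soloInformedJoint_padicRegulatorOf_eq_zero_of_lt {r : ℕ} (hE : hasEntireLFunction_rat)
    (hp : 5 ≤ p) (hord : IsOrdinaryAt W p) (D : WeierstrassCurve.PAdicHeightData W p)
    (hf : IsNewformOf W f) (hKato : kato_selmerCorank_le_order_padicLFunction W p (f := f))
    {P : Fin r → W.toAffine.Point} {c : ℚ}
    (hL : W.leadingLCoeff = (((c : ℝ) * plusPeriod f * regulatorOf P : ℝ) : ℂ))
    (hLp : PowerSeries.coeff r (padicLFunction f (unitRoot W p : ℚ_[p])) *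
          padicLog p (cyclotomicGenerator p) ^ r =
        (c : ℚ_[p]) * (1 - (unitRoot W p : ℚ_[p])⁻¹) ^ 2 * padicRegulatorOf D P)
    (hlt : r < W.mordellWeilRank) :
    padicRegulatorOf D P = 0 ∧ PowerSeries.coeff r (padicLFunction f (unitRoot W p : ℚ_[p])) = 0 := by
  obtain ⟨hc, -⟩ := soloInformedJoint_ne_zero_of_leadingLCoeff W f hE hL
  have hp2 : p ≠ 2 := by omega
  have hKato' : (W.selmerCorank p : ℕ∞) ≤ (padicLFunction f (unitRoot W p : ℚ_[p])).order :=
    hKato hp2 hord hf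
  have hid : W.selmerCorank p = W.mordellWeilRank + W.shaCorank p :=
    W.selmerCorank_eq_mordellWeilRank_add_holds p
  have hrlt : ((r : ℕ) : ℕ∞) < (padicLFunction f (unitRoot W p : ℚ_[p])).order := by
    refine lt_of_lt_of_le ?_ hKato'
    exact_mod_cast (show r < W.selmerCorank p by omega)
  have hcoeff : PowerSeries.coeff r (padicLFunction f (unitRoot W p : ℚ_[p])) = 0 :=
    PowerSeries.coeff_of_lt_order r hrlt
  refine ⟨?_, hcoeff⟩
  have hα : (1 : ℚ_[p]) - ((unitRoot W p : ℤ_[p]) : ℚ_[p])⁻¹ ≠ 0 :=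
    one_sub_unitRoot_inv_ne_zero W p hord
  have hcp : (c : ℚ_[p]) ≠ 0 := by exact_mod_cast hc
  have h0 : (c : ℚ_[p]) * (1 - (unitRoot W p : ℚ_[p])⁻¹) ^ 2 * padicRegulatorOf D P = 0 := by
    rw [← hLp, hcoeff, zero_mul]
  rcases mul_eq_zero.mp h0 with h | h
  · exact absurd h (mul_ne_zero hcp (pow_ne_zero _ hα))
  · exact h

end OneCurve

/-- **`PAdicHeightAnisotropic` implies Schneider's conjecture for the canonical datum.** A
Mordell–Weil basis exists (`exists_isMordellWeilBasis_holds`, Mordell–Weil) and has positive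
Néron–Tate Gram determinant (`regulatorOf_pos_of_isMordellWeilBasis`, Silverman AEC Cor. VIII.9.7);
anisotropy then makes its `p`-adic Gram determinant, which is `Reg_p(E,D)` by definition of
`padicRegulator`, non-zero. Shows the family hypothesis is at least as strong as
`SchneiderConjecture`. [cite: Schneider1982PadicHeightI, §1] -/
theorem soloInformedJoint_schneider_of_anisotropic (hA : PAdicHeightAnisotropic)
    (W : WeierstrassCurve ℚ) [W.IsElliptic] [W.IsGloballyMinimal] (p : ℕ) [Fact p.Prime]
    (D : WeierstrassCurve.PAdicHeightData W p) (hp : 5 ≤ p) (hord : IsOrdinaryAt W p)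
    (hD : D.IsCanonical) : SchneiderConjecture D := by
  have hB : ∃ (n : ℕ) (P : Fin n → W.toAffine.Point), IsMordellWeilBasis P :=
    ⟨W.mordellWeilRank, W.exists_isMordellWeilBasis_holds⟩
  unfold SchneiderConjecture padicRegulator
  rw [dif_pos hB]
  exact hA W p D hp hord hD _ (regulatorOf_pos_of_isMordellWeilBasis hB.choose_spec.choose_spec).ne'

/-- **`BirchSwinnertonDyer` from the joint higher Gross–Zagier identity and `p`-adic anisotropy.**
The RANK conjecture `r_an(E) = rank E(ℚ)` for every elliptic curve over `ℚ` follows from: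
Gross–Zagier–Kolyvagin in analytic rank `≤ 1` (`rank_eq_analyticRank_of_analyticRank_le_one`,
Darmon CBMS 101 Thm. 3.22); modularity as entire continuation (`hasEntireLFunction_rat`) and as a
newform (`exists_isNewformOf`, BCDT 2001); the supply of a good ordinary prime `p ≥ 5`
(`exists_good_ordinary_prime`, Serre 1981 §8 / Deuring) and of the canonical height datum
(`exists_isCanonical`); Kato's theorem `corank Sel_{p^∞} ≤ ord L_p` (Thm. 18.4) — and exactly TWO
open inputs: `(ZZ_r)` for every `r ≥ 2` and `PAdicHeightAnisotropic`. Proof: pass to a global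
minimal model (`hasGlobalMinimalModel_rat_holds`; `r_an` and `rank` are invariant,
`analyticRank_variableChange_holds`, `mordellWeilRank_variableChange_holds`), pick `p`, `D`, `f`,
and apply `soloInformedJoint_rank_eq`. [cite: Darmon2004, Thm. 3.22 (= Thm. 1.14) and §3.9] -/
theorem soloInformedJoint_birchSwinnertonDyer
    (hGZK : rank_eq_analyticRank_of_analyticRank_le_one)
    (hE : hasEntireLFunction_rat) (hMod : exists_isNewformOf)
    (hOrd : WeierstrassCurve.exists_good_ordinary_prime) (hCan : exists_isCanonical)
    (hKato : ∀ (W : WeierstrassCurve ℚ) [W.IsElliptic] [W.IsGloballyMinimal] (p : ℕ) [Fact p.Prime]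
      {N : ℕ} [NeZero N] {f : CuspForm (Gamma0 N) 2},
      kato_selmerCorank_le_order_padicLFunction W p (f := f))
    (hZZ : ∀ r : ℕ, 2 ≤ r → JointHigherGrossZagier r)
    (hA : PAdicHeightAnisotropic) :
    BirchSwinnertonDyer := by
  unfold BirchSwinnertonDyer Literature.BSDRankConjecture
  intro W hW
  by_cases h2 : 2 ≤ W.analyticRank
  · haveI := hW
    obtain ⟨C, hC⟩ := hasGlobalMinimalModel_rat_holds W
    haveI := hC
    have hran : (C • W).analyticRank = W.analyticRank := analyticRank_variableChange_holds W C
    have hmw : (C • W).mordellWeilRank = W.mordellWeilRank := mordellWeilRank_variableChange_holds W C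
    rw [← hran, ← hmw]
    rw [← hran] at h2
    set V := C • W with hV
    obtain ⟨p, hpF, hp5, hgood, hnd⟩ := hOrd V
    have hordV : IsOrdinaryAt V p := ⟨hgood, hnd⟩
    obtain ⟨D, hD⟩ := hCan V p hp5 hgood hnd
    haveI : NeZero (V.conductorNorm ℤ) := ⟨(V.conductorNorm_pos_holds).ne'⟩
    obtain ⟨f, hf⟩ := hMod V
    exact ((soloInformedJoint_rank_eq V p f (hZZ _ h2) hE hp5 hordV rfl D hD hf (hKato V p)
      (fun P hP => hA V p D hp5 hordV hD P hP)).1).symm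
  · have h1 : W.analyticRank ≤ 1 := by omega
    haveI := hW
    exact (hGZK W h1).1.symm

end Summit.BirchSwinnertonDyer.BirchSwinnertonDyer.Theorems

end
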